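import Literature.NumberTheory.GaloisRepresentations.AbsGaloisGroup

/-!
# The absolute Galois group is compact in every characteristic

Sibling proof file of `Literature/NumberTheory/GaloisRepresentations/AbsGaloisGroup.lean`, which
transports Mathlib's `CompactSpace Gal(K/k)` (available for `[IsGalois k K]`,
`Mathlib/FieldTheory/Galois/Profinite.lean`) to `Field.absoluteGaloisGroup K = Aut_K(K̄)` only
under `[CharZero K]` (`Field.absoluteGaloisGroup.instCompactSpace`), because `K̄ / K` is not
Galois when `K` is imperfect — e.g. for local fields of positive characteristic.  Here:

* `Literature.NumberTheory.GaloisRepresentations.perfectField_fixedField_top`: the fixed field `K₀ = K̄^{Aut_K(K̄)}` is perfect (a `p`-th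
  root of a fixed element is fixed, Frobenius being injective on `K̄`);
* `Literature.NumberTheory.GaloisRepresentations.isGalois_fixedField_top`: `K̄ / K₀` is Galois;
* `Literature.NumberTheory.GaloisRepresentations.restrictScalars_fixedField_top_bijective`, `Literature.NumberTheory.GaloisRepresentations.continuous_restrictScalars_fixedField_top`:
  restriction of scalars `Gal(K̄/K₀) → Aut_K(K̄)` is a continuous bijection (Krull topologies);
* `Literature.NumberTheory.GaloisRepresentations.compactSpace_algebraicClosure_algEquiv`, `Literature.NumberTheory.GaloisRepresentations.absoluteGaloisGroup_compactSpace`: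
  `Aut_K(K̄)` and `absoluteGaloisGroup K` are compact for **every** field `K`.

(`Literature.NumberTheory.EllipticCurves.compactSpace_absoluteGaloisGroup` in `EllipticCurves/SelmerCorankProofs.lean` is the
`[PerfectField K]` case, by the same one-line transport as the `CharZero` instance.)

## References

* J. Neukirch, *Algebraic Number Theory*, Springer 1999, Ch. IV §1, (1.1) (profinite Galois
  groups).  [NeukirchANT1999]
* J. S. Milne, *Fields and Galois Theory*, Ch. 7 (Krull topology; infinite Galois theory).
  [MilneFT2022]
-/

noncomputable section

namespace Literature.NumberTheory.GaloisRepresentations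

open Field

/-! ### Compactness of the absolute Galois group in every characteristic

`AbsGaloisGroup.lean` transports Mathlib's `CompactSpace Gal(K/k)` (for `[IsGalois k K]`) to
`absoluteGaloisGroup K` only under `[CharZero K]`, because `K̄ / K` is not Galois when `K` is
imperfect.  In general `Aut_K(K̄) = Gal(K̄ / K₀)` where `K₀ = K̄^{Aut_K(K̄)}` is the perfect
closure of `K` in `K̄`; `K̄ / K₀` *is* Galois (`K₀` is perfect: a `p`-th root of a fixed element
is fixed, Frobenius being injective), restriction of scalars `Gal(K̄/K₀) → Aut_K(K̄)` is a
continuous bijection for the Krull topologies, and so `Aut_K(K̄)` is compact as the continuous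
image of a compact space.
-/

section Compact

variable (K : Type*) [Field K]

open IntermediateField in
/-- The fixed field `K₀ = K̄^{Aut_K(K̄)}` of the full automorphism group is perfect: if `y` is
fixed by every `K`-automorphism of `K̄` then so is its (unique) `p`-th root.
Ref: Milne, *Fields and Galois Theory*, Ch. 7 (infinite Galois theory; the perfect closure).
[folklore] -/
theorem perfectField_fixedField_top :
    PerfectField (fixedField (⊤ : Subgroup (AlgebraicClosure K ≃ₐ[K] AlgebraicClosure K))) := by
  set K₀ := fixedField (⊤ : Subgroup (AlgebraicClosure K ≃ₐ[K] AlgebraicClosure K)) with hK₀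
  obtain ⟨p, hp⟩ := ExpChar.exists (AlgebraicClosure K)
  haveI : ExpChar K₀ p :=
    (algebraMap K₀ (AlgebraicClosure K)).expChar (algebraMap K₀ (AlgebraicClosure K)).injective p
  haveI : PerfectRing K₀ p := by
    refine PerfectRing.ofSurjective K₀ p fun y => ?_
    obtain ⟨z, hz⟩ :=
      IsAlgClosed.exists_pow_nat_eq (y : AlgebraicClosure K) (expChar_pos (AlgebraicClosure K) p)
    have hzmem : z ∈ K₀ := by
      rw [hK₀, mem_fixedField_iff]
      intro σ _
      apply frobenius_inj (AlgebraicClosure K) p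
      rw [frobenius_def, frobenius_def, ← map_pow, hz]
      exact (mem_fixedField_iff _ _).mp y.2 σ (Subgroup.mem_top σ)
    refine ⟨⟨z, hzmem⟩, Subtype.ext ?_⟩
    rw [frobenius_def, SubmonoidClass.mk_pow]
    exact hz
  exact PerfectRing.toPerfectField K₀ p

open IntermediateField in
/-- `K̄` is Galois over the fixed field `K₀` of `Aut_K(K̄)` (normal as an algebraic closure,
separable because `K₀` is perfect).
Ref: Milne, *Fields and Galois Theory*, Ch. 7. [folklore] -/
theorem isGalois_fixedField_top :
    IsGalois (fixedField (⊤ : Subgroup (AlgebraicClosure K ≃ₐ[K] AlgebraicClosure K)))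
      (AlgebraicClosure K) := by
  set K₀ := fixedField (⊤ : Subgroup (AlgebraicClosure K ≃ₐ[K] AlgebraicClosure K))
  haveI : Algebra.IsAlgebraic K₀ (AlgebraicClosure K) :=
    Algebra.IsAlgebraic.tower_top (K := K) K₀
  haveI : PerfectField K₀ := perfectField_fixedField_top K
  haveI : Algebra.IsSeparable K₀ (AlgebraicClosure K) :=
    Algebra.IsAlgebraic.isSeparable_of_perfectField
  haveI : IsAlgClosure K₀ (AlgebraicClosure K) := ⟨inferInstance, inferInstance⟩
  exact isGalois_iff.mpr ⟨inferInstance, IsAlgClosure.normal K₀ (AlgebraicClosure K)⟩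

open IntermediateField in
/-- Restriction of scalars `Gal(K̄/K₀) → Aut_K(K̄)` (`K₀` the fixed field of `Aut_K(K̄)`) is
bijective: every `K`-automorphism of `K̄` fixes `K₀` pointwise.
Ref: Milne, *Fields and Galois Theory*, Ch. 7. [folklore] -/
theorem restrictScalars_fixedField_top_bijective :
    Function.Bijective fun σ : AlgebraicClosure K ≃ₐ[fixedField
      (⊤ : Subgroup (AlgebraicClosure K ≃ₐ[K] AlgebraicClosure K))] AlgebraicClosure K =>
        σ.restrictScalars K := by
  constructor
  · intro σ τ h
    ext x
    exact AlgEquiv.congr_fun h x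
  · intro τ
    refine ⟨{ τ.toRingEquiv with commutes' := fun x => ?_ }, ?_⟩
    · exact (mem_fixedField_iff _ _).mp x.2 τ (Subgroup.mem_top τ)
    · ext x
      rfl

open IntermediateField in
/-- Restriction of scalars `Gal(K̄/K₀) → Aut_K(K̄)` is continuous for the Krull topologies: the
preimage of `Gal(K̄/L)`, `L/K` finite, contains `Gal(K̄/K₀(b))` for a `K`-basis `b` of `L`.
Ref: Milne, *Fields and Galois Theory*, Ch. 7. [folklore] -/
theorem continuous_restrictScalars_fixedField_top :
    Continuous fun σ : AlgebraicClosure K ≃ₐ[fixedField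
      (⊤ : Subgroup (AlgebraicClosure K ≃ₐ[K] AlgebraicClosure K))] AlgebraicClosure K =>
        σ.restrictScalars K := by
  set K₀ := fixedField (⊤ : Subgroup (AlgebraicClosure K ≃ₐ[K] AlgebraicClosure K))
  haveI : Algebra.IsAlgebraic K₀ (AlgebraicClosure K) :=
    Algebra.IsAlgebraic.tower_top (K := K) K₀
  -- restriction of scalars as a group homomorphism
  let r : (AlgebraicClosure K ≃ₐ[K₀] AlgebraicClosure K) →*
      (AlgebraicClosure K ≃ₐ[K] AlgebraicClosure K) :=
    { toFun := fun σ => σ.restrictScalars K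
      map_one' := by ext; rfl
      map_mul' := fun _ _ => by ext; rfl }
  change Continuous r
  refine continuous_of_continuousAt_one r (continuousAt_def.mpr ?_)
  intro s hs
  rw [map_one] at hs
  obtain ⟨L, hL, hLs⟩ := (krullTopology_mem_nhds_one_iff K (AlgebraicClosure K) s).mp hs
  -- `L₀ = K₀(b)`, `b` a `K`-basis of `L`
  let b := Module.finBasis K L
  let S : Set (AlgebraicClosure K) := Set.range fun i => (b i : AlgebraicClosure K)
  let L₀ : IntermediateField K₀ (AlgebraicClosure K) := IntermediateField.adjoin K₀ S
  haveI : FiniteDimensional K₀ L₀ :=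
    IntermediateField.finiteDimensional_adjoin fun x _ => Algebra.IsIntegral.isIntegral x
  refine Filter.mem_of_superset ((IntermediateField.fixingSubgroup_isOpen L₀).mem_nhds
    (one_mem _)) fun σ hσ => hLs ?_
  rw [SetLike.mem_coe, IntermediateField.mem_fixingSubgroup_iff] at hσ ⊢
  intro x hx
  -- write `x = ∑ cᵢ • bᵢ` and use that `σ` fixes each `bᵢ ∈ L₀`
  have hb : ∀ i, σ (b i : AlgebraicClosure K) = b i := fun i =>
    hσ _ (IntermediateField.subset_adjoin K₀ S ⟨i, rfl⟩)
  have hx' : (⟨x, hx⟩ : L) = ∑ i, b.repr ⟨x, hx⟩ i • b i := (b.sum_repr ⟨x, hx⟩).symm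
  have hx'' : x = ∑ i, b.repr ⟨x, hx⟩ i • (b i : AlgebraicClosure K) := by
    have h := congrArg L.val hx'
    rw [map_sum] at h
    simp_rw [map_smul] at h
    exact h
  change σ.restrictScalars K x = x
  rw [hx'', map_sum]
  refine Finset.sum_congr rfl fun i _ => ?_
  rw [map_smul, AlgEquiv.restrictScalars_apply, hb i]

/-- **The absolute Galois group is compact** (every characteristic): `Aut_K(K̄)` is the
continuous bijective image of the profinite group `Gal(K̄/K₀)`.
Ref: Neukirch, *Algebraic Number Theory* (1999), Ch. IV (1.1); Milne, *Fields and Galois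
Theory*, Ch. 7. [folklore] -/
theorem compactSpace_algebraicClosure_algEquiv :
    CompactSpace (AlgebraicClosure K ≃ₐ[K] AlgebraicClosure K) := by
  haveI := isGalois_fixedField_top K
  refine ⟨?_⟩
  rw [← (restrictScalars_fixedField_top_bijective K).2.range_eq]
  exact isCompact_range (continuous_restrictScalars_fixedField_top K)

/-- **The absolute Galois group `absoluteGaloisGroup K` is compact**, for every field `K`
(generalises `Field.absoluteGaloisGroup.instCompactSpace` of `AbsGaloisGroup.lean`, which assumes
`CharZero K`, and `Literature.NumberTheory.EllipticCurves.compactSpace_absoluteGaloisGroup` of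
`EllipticCurves/SelmerCorankProofs.lean`, which assumes `PerfectField K`; imperfect fields — e.g.
local fields of positive characteristic — need the argument through the perfect closure `K₀`).
Ref: Neukirch, *Algebraic Number Theory* (1999), Ch. IV (1.1). [folklore] -/
theorem absoluteGaloisGroup_compactSpace : CompactSpace (absoluteGaloisGroup K) :=
  compactSpace_algebraicClosure_algEquiv K

end Compact

end Literature.NumberTheory.GaloisRepresentations
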